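import Summits.ResolutionOfSingularities.ResolutionOfSingularities.Theorems.EquisingularLiftEquisingularLiftNatNoseRoundStageOfModel
import Summits.ResolutionOfSingularities.ResolutionOfSingularities.Theorems.EquisingularLiftEquisingularLiftNatEquinodalJInitOfNoseDatum
import Summits.ResolutionOfSingularities.ResolutionOfSingularities.Theorems.EquisingularLiftEquisingularLiftNatEquinodalHyperplaneLift
import Summits.ResolutionOfSingularities.ResolutionOfSingularities.Theorems.EquisingularLiftEquisingularLiftNatEquinodalHostNormalForm
import Summits.ResolutionOfSingularities.ResolutionOfSingularities.Theorems.EquisingularLiftEquisingularLiftNatResidueHypDefsE4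
import Summits.ResolutionOfSingularities.ResolutionOfSingularities.Theorems.EquisingularLiftEquisingularLiftNatPlanarTraceSmoothing
import Summits.ResolutionOfSingularities.ResolutionOfSingularities.Theorems.EquisingularLiftEquisingularLiftNatInitialDoorEngine
import Summits.ResolutionOfSingularities.ResolutionOfSingularities.Theorems.EquisingularLiftEquisingularLiftNatHostedRoundSeam
import Summits.ResolutionOfSingularities.ResolutionOfSingularities.Theorems.EquisingularLiftEquisingularLiftNatHostedPointStepSeam
import Summits.ResolutionOfSingularities.ResolutionOfSingularities.Theorems.EquisingularLiftEquisingularLiftNatHostedEngineInit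
import Summits.ResolutionOfSingularities.ResolutionOfSingularities.Theorems.EquisingularLiftEquisingularLiftNatNoseHostedHSUB
import Summits.ResolutionOfSingularities.ResolutionOfSingularities.Theorems.EquisingularLiftEquisingularLiftNatHSUBeOfSuppliers
import Summits.ResolutionOfSingularities.ResolutionOfSingularities.Theorems.EquisingularLiftEquisingularLiftNatResidueHypDefs
import Summits.ResolutionOfSingularities.ResolutionOfSingularities.Theorems.EquisingularLiftEquisingularLiftNatResidueHypDefsE3
import Summits.ResolutionOfSingularities.ResolutionOfSingularities.Theorems.EquisingularLiftEquisingularLiftNatNoseTrace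
import Summits.ResolutionOfSingularities.ResolutionOfSingularities.Theorems.EquisingularLiftEquisingularLiftNatNoseRoundStep
import Summits.ResolutionOfSingularities.ResolutionOfSingularities.Theorems.EquisingularLiftEquisingularLiftNatEquinodalJInitOfNearNode
import Summits.ResolutionOfSingularities.ResolutionOfSingularities.Theorems.EquisingularLiftEquisingularLiftNatEquinodalCoreNoseRegularNode
import HarnessLib

/-!
# [OURS · L1 W4.5(b) · EL♮(3) · WIDTH TABLE D9 «ν3-DIRECT»] RUNGᵈ — (ε) THE UPSTAIRS SUPPLIER `Direct.hsubd_of_smoothing` AND (ζ) THE RUNG (R-ν3ᵈ) `nose_direct_rung_three`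
# `(T-k) → p.Prime → … → NoseHypHostedNestEquinodalDirectBTriplePrime₂ k 3 H ι → ELNatConclusionO k 3 H ι`

res-L1-w45b-stub-4 g14/g15 (pen of RUNGᵈ by the desk's RULING R71 (ii), WORD g25-26 (3), RULING R71b (ii) KEEP; plan l.85889).  ONE module, TWO theorems
(the (ε) → (ζ) split into `…NatNoseDirectHSUB` + `…NatNoseDirectRung` announced on the bus is merged here: one gate round-trip instead of two; the 46th
texts import exactly this module and ✓ `…NatResidueHypDefsE4`, desk acceptance test `nose46.json` f0dd7243428471e4 [A]).

## (ε) `Direct.hsubd_of_smoothing` — the K5ⁱ engine's HSUBⁱ slot at the door ν3ᵈ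

WHAT.  The HSUBⁱ slot of
res-L1-w45b-nose-w1's door-parametric engine K5ⁱ ✓ `target_elnat_of_hostedSubchainResolutionᵢ` (`…NatInitialDoorEngine`) asks, at the INITIAL stage
`(ℙ³_O, 𝟙, range (ι ≫ Proj φ))` with the initial host model `𝓔₀` (a `TCPlus.LetterDatum … E₀`), that every move of the initial-stage door be matched by a
new upstairs stage `(X₉, σ₉, S₉)` — chain member, integral, locally noetherian, regular, dominant — with a model square for the reached `(F₉, T₉)` and a host
model for `E₉`.  Piece (ε) supplies it for the door ν3ᵈ «DIRECT PLANAR NOSE» `ReachDirectPlanarNose₂ k 3 ℓ (range ι) F₉ β T₉ E₉` (tree text ✓ p703167: `E₉ = ∅`; a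
closed infinite preirreducible `Z ⊆ range ι ∩ V₊ℓ`, `¬ range ι ⊆ Z`; curve / ambient-regular / host-regular / host-two-dimensional clauses along `Z̃`; (N1) finitely many
non-regular points of `Z̃`; the EQUATION block `g` homogeneous of degree `e`, `Squarefree (restrictToHyperplane B g)`, `Z = V₊ℓ ∩ V₊g`, `restrictToHyperplane B ℓ = 0`,
`r` injective with invertible minor; then the nose blow-up `υ' : F₃ → ℙ³_k` of `𝓘⟨Z⟩` and a B‴ tail `γ' : F₉ → F₃`, `β = γ' ≫ υ'`).
HOW (pure composition):  (1) the host's LINEAR normal form — `ℓ₀` linear with `V₊ℓ = V₊ℓ₀` (the engine's `hE₀'`; the case `E₀ = ∅` is absurd since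
`∅ ≠ Z ⊆ V₊ℓ = E₀`) and `λ := Σₐ θ(c̃ₐ)·xₐ` from ✓ `Equinodal.HyperplaneLift.exists_hyperplane_lift` on the door's `(B, r)` (so `λ ∣ ℓ`, `restrictToHyperplane B λ = 0`),
whence `V₊ℓ = V₊λ` by ✓ `Equinodal.HostNormalForm.setOf_mem_eq_setOf_mem_linear`, `Z = V₊λ ∩ V₊g`, and the host-regular clause transported along `V₊ℓ = V₊λ`
(by `subst` on a generalised set; `rw` cannot, the closure proof is frozen);  (2) THE CENTRE `C₀ := 𝓦` of res-L1-w45b-stub-2's ✓ `Equinodal.planar_trace_smoothing`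
(the explicit planar smoothing `V(λ̃, g̃ + ϖU) ⊂ ℙ³_O`: `V(𝓦)` regular, `O`-flat, `𝓦.comap (Proj φ) = 𝓘⟨Z⟩`) fed `λ`, `Z`, the transported host clause, (N1) and the
equation block — NO J-initial step and NO (T-k) call for the centre (the smoothing IS the centre);  (3) THE MOVE UPSTAIRS = ONE call of res-L1-w45b-nose-w1's
✓ `Equinodal.directNose_stage_zero_of_model` (`…NatNoseRoundStageOfModel`, p702606: the stage-0 HEND block from the model `C₀` — base model square
✓ `ProjectiveAmbientFibre.isPullback_projMap`, dominance —, then ✓ `hsube_of_suppliers`' PHASE 2 verbatim: centre off the generic point, ✓ `exists_isBlowup` +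
✓ `modelStep_chain`, the B‴ tail through ✓ `hsub_reachNoseTowerBTriplePrime_of_fact'` fed with (T-k) `hF`, host dropped).  The door's `IsPreirreducible Z`,
ambient-regular and host-two-dimensional conjuncts (`hZirr`, `hGreg`, `hEdim`; kept by the desk's R71b (ii) — the n-scope / letter of record Σ1) are bound and not read here.
OURS; NOT a statement of any manuscript ([Hironaka2017] is a candidate under adjudication, nothing of it is asserted); AI-written, weaker than expert review.
No `sorry`; standard axioms; DEF-FREE; the residue (T-k) `EmbeddedCurveLiftFact` is a HYPOTHESIS `hF` exactly as in ✓ `hsube_of_suppliers`.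
`--supports stmt-ResolutionOfSingularities-20148 --as helper`.  EL♮(3) is NOT proved here; resolution in positive characteristic is NOT proved anywhere in this tree.
[folklore; pure composition]

## (ζ) `nose_direct_rung_three` — THE RUNG (R-ν3ᵈ)

WHAT.  The rung of the door
«ν4 ∨ ν3ᵈ» = «EQUINODAL PLANAR NOSE ∨ DIRECT PLANAR NOSE» (`NoseHypHostedNestEquinodalDirectBTriplePrime₂`, ✓ `…NatResidueHypDefsE4`, res-type-027 g23):
surfaces `H ⊂ ℙ³_k` whose downstairs resolution motive is closed under hosted point steps, stage-level hosted rounds, `ReachHostedNoseBTriplePrime`-moves and,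
at the initial stage with hyperplane host `E₀ = V₊(ℓ)`, under EITHER initial-stage planar-nose door, satisfy EL♮(3)'s conclusion `ELNatConclusionO k 3 H ι`,
GIVEN the residue (T-k) `EmbeddedCurveLiftFact` (a HYPOTHESIS, exactly as for the rungs (R-ν1)–(R-ν4); the texts feed it `stub_elnat_embeddedCurveLiftFact`).
The type is the 46th texts' call shape (desk acceptance test `nose46.json` f0dd7243428471e4 [D]; res-L1-w45b-lead-2 g9 kit l.85937): RUNGᵉ's
✓ `stub_elnat_hostedNestEquinodalNoseBTriplePrimeResolutionThree` (`…NatNoseEquinodalRung`) binder convention VERBATIM with the ONE token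
`NoseHypHostedNestEquinodalBTriplePrime₂ ↦ NoseHypHostedNestEquinodalDirectBTriplePrime₂`.

PROOF = ONE application of res-L1-w45b-nose-w1 g6's door-parametric engine K5ⁱ ✓ `target_elnat_of_hostedSubchainResolutionᵢ` (`…NatInitialDoorEngine`) at
`n := 3`, `ReachH := ReachHostedNoseBTriplePrime`, `ReachI := fun ℓ F₉ β T₉ E₉ ↦ ReachEquinodalPlanarNose₂ k 3 ℓ (range ι) F₉ β T₉ E₉ ∨ ReachDirectPlanarNose₂ k 3 ℓ (range ι) F₉ β T₉ E₉`
(027's placement (b): the «∨» sits where ν4's door sits, so `hres` := the blob's body after `obtain`), with the suppliers BY NAME exactly as RUNGᵉ ✓ p694375: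
HINIT = ✓ `hinit_empty` / ✓ `hinit_hyperplane` (res-L1-w45b-stub-2; by cases on `E₀`), HPT = ✓ `TCPlus.hpt_seam k 3` (res-L1-w45b-stub-4), HROUND = ✓ `TCPlus.hround_seam k hF`
(stub-2), HSUBʰ = ✓ `hsubh_reachHostedNoseBTriplePrime_of_embeddedCurveLiftFact hF k` (res-L1-w45b-nose-w2), and the disjunctive initial-door supplier
`HSUBⁱ := hR.elim HSUBᵉ HSUBᵈ`: HSUBᵉ = ✓ `Equinodal.hsube_of_suppliers` (res-L1-w45b-nose-w1) at `RD := Equinodal.RPlus` over ✓ `Equinodal.jinit_rPlus₀_of_nearNode` /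
✓ `Equinodal.nose_regular_near_node` / ✓ `Equinodal.hnode_rPlus` / ✓ `Equinodal.hrdz_rPlus` / ✓ `Equinodal.hend_rPlus` (ν4, verbatim from RUNGᵉ), HSUBᵈ = `Direct.hsubd_of_smoothing`
(RUNGᵈ piece (ε) ABOVE: the EXPLICIT SMOOTHING CENTRE of res-L1-w45b-stub-2's Σ1 lemma ✓ `Equinodal.planar_trace_smoothing`, then res-L1-w45b-nose-w1's
✓ `directNose_stage_zero_of_model` = ✓ `hsube_of_suppliers`' PHASE 2).  `hE₀'` = the blob's host disjunction minus its `¬ range ι ⊆ V₊ℓ` conjunct (desk WORD g25-17 shape (B)).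
OURS; NOT a statement of any manuscript ([Hironaka2017] is a candidate under adjudication, nothing of it is asserted); AI-written, weaker than expert review.
No `sorry`; standard axioms; DEF-FREE; `--supports stmt-ResolutionOfSingularities-20148 --as helper`.  EL♮(3) is NOT proved here: the rung moves the surfaces of
the widened door out of the non-isolated residue; after the 46th REPLACE the nose residue reads `¬ NoseHypHostedNestEquinodalDirectBTriplePrime₂` and Σ2/Σ3/Σ5/Σ6/Σ7
and every non-planar nose remain OUTSIDE by letters (idea-2 NU7 v1.2); resolution in positive characteristic is NOT proved anywhere in this tree.
[folklore; pure composition]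
-/
set_option linter.dupNamespace false -- mandated namespace `Summit.<Summit>.<Problem>` of this single-conjunct summit
set_option linter.overlappingInstances false -- signatures carry `[IsDomain O] [IsDiscreteValuationRing O]`

noncomputable section

open CategoryTheory CategoryTheory.Limits AlgebraicGeometry TopologicalSpace Topology IsLocalRing
open MvPolynomial
open Literature.AlgebraicGeometry.Resolution
open AlgebraicGeometry.Scheme.IdealSheafData
open Summit.ResolutionOfSingularities.ResolutionOfSingularities.Theses.EquisingularLift.Split
open Summit.ResolutionOfSingularities.ResolutionOfSingularities.Cruxes.EquisingularLift.StrataSplit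

namespace Summit.ResolutionOfSingularities.ResolutionOfSingularities.Cruxes.EquisingularLiftNat.Sections.Direct

/-- ★★ **HSUBᵈ FROM THE SMOOTHING — the K5ⁱ engine's HSUBⁱ slot at the door ν3ᵈ `ReachDirectPlanarNose₂ k 3 ℓ (range ι)`** (composition: stage-0
bookkeeping, the host's linear normal form, the CENTRE = res-L1-w45b-stub-2's explicit planar smoothing ✓ `Equinodal.planar_trace_smoothing`, then PHASE 2 of
✓ `Equinodal.hsube_of_suppliers` verbatim and the B‴ tail via ✓ `hsub_reachNoseTowerBTriplePrime_of_fact'`).  Binders = the HSUBⁱ slot of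
✓ `target_elnat_of_hostedSubchainResolutionᵢ` at `n := 3` behind `(hF) (k) (H) (ι) (hι) (hH) (E₀) (hE₀')`; see the module docstring.
[OURS · L1 W4.5b · RUNGᵈ (ε); NOT a statement of the manuscript; EL♮(3) NOT proved] -/
theorem hsubd_of_smoothing (hF : EmbeddedCurveLiftFact) (k : Type) [Field k] [IsAlgClosed k] (H : Scheme.{0})
    (ι : H ⟶ (Literature.AlgebraicGeometry.Motives.projectiveSpace 3 k).left)
    (hι : AlgebraicGeometry.IsClosedImmersion ι) (hH : AlgebraicGeometry.IsIntegral H)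
    (E₀ : Set (Literature.AlgebraicGeometry.Motives.projectiveSpace 3 k).left)
    (hE₀' : letI := MvPolynomial.gradedAlgebra (σ := Fin (3 + 1)) (R := k)
      E₀ = ∅ ∨ ∃ ℓ₀ : MvPolynomial (Fin (3 + 1)) k, ℓ₀.IsHomogeneous 1 ∧ ℓ₀ ≠ 0 ∧
        E₀ = {y : (Literature.AlgebraicGeometry.Motives.projectiveSpace 3 k).left | ℓ₀ ∈ (y : ProjectiveSpectrum (MvPolynomial.homogeneousSubmodule (Fin (3 + 1)) k)).asHomogeneousIdeal}) :
    ∀ (O : Type) [CommRing O] [IsDomain O] [IsDiscreteValuationRing O] [IsAdicComplete (IsLocalRing.maximalIdeal O) O] [IsAlgClosed (IsLocalRing.ResidueField O)] (θ : O →+* k), Function.Surjective θ →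
      (letI := MvPolynomial.gradedAlgebra (σ := Fin (3 + 1)) (R := O); letI := MvPolynomial.gradedAlgebra (σ := Fin (3 + 1)) (R := k);
       ∀ (φ : MvPolynomial.homogeneousSubmodule (Fin (3 + 1)) O →+*ᵍ MvPolynomial.homogeneousSubmodule (Fin (3 + 1)) k)
        (hφ' : HomogeneousIdeal.irrelevant (MvPolynomial.homogeneousSubmodule (Fin (3 + 1)) k) ≤ (HomogeneousIdeal.irrelevant (MvPolynomial.homogeneousSubmodule (Fin (3 + 1)) O)).map φ), (∀ s, φ s = MvPolynomial.map θ s) →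
      ∀ (Ch : ∀ X' : AlgebraicGeometry.Scheme.{0}, (X' ⟶ (AlgebraicGeometry.Proj (MvPolynomial.homogeneousSubmodule (Fin (3 + 1)) O))) → Set X' → Prop),
        (∀ (X' X'' : AlgebraicGeometry.Scheme.{0}) (σ' : X' ⟶ (AlgebraicGeometry.Proj (MvPolynomial.homogeneousSubmodule (Fin (3 + 1)) O))) (S' : Set X') (C : X'.IdealSheafData) (τ : X'' ⟶ X'), Ch X' σ' S' → Literature.AlgebraicGeometry.Resolution.IsBlowup τ C →
          Literature.AlgebraicGeometry.Resolution.Scheme.IsRegular C.subscheme → AlgebraicGeometry.Flat (C.subschemeι ≫ σ' ≫ (AlgebraicGeometry.Proj.toSpecZero (MvPolynomial.homogeneousSubmodule (Fin (3 + 1)) O) ≫ AlgebraicGeometry.Spec.map (CommRingCat.ofHom (algebraMap O (MvPolynomial.homogeneousSubmodule (Fin (3 + 1)) O 0))))) → σ' '' (C.support : Set X') ⊆ {y | ¬ IsGenericPoint y (Set.range (ι ≫ AlgebraicGeometry.Proj.map φ hφ' : H ⟶ (AlgebraicGeometry.Proj (MvPolynomial.homogeneousSubmodule (Fin (3 + 1))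 O))))} →
          (C.support : Set X') ∩ (σ' ≫ (AlgebraicGeometry.Proj.toSpecZero (MvPolynomial.homogeneousSubmodule (Fin (3 + 1)) O) ≫ AlgebraicGeometry.Spec.map (CommRingCat.ofHom (algebraMap O (MvPolynomial.homogeneousSubmodule (Fin (3 + 1)) O 0))))) ⁻¹' {IsLocalRing.closedPoint O} ⊆ S' → Ch X'' (τ ≫ σ') (closure (τ ⁻¹' (S' \ (C.support : Set X'))))) → (∀ (X' : AlgebraicGeometry.Scheme.{0}) (σ' : X' ⟶ (AlgebraicGeometry.Proj (MvPolynomial.homogeneousSubmodule (Fin (3 + 1)) O))) (S' : Set X'), Ch X' σ' S' →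
          Summit.ResolutionOfSingularities.ResolutionOfSingularities.Theses.EquisingularLift.Split.Chain (AlgebraicGeometry.Proj (MvPolynomial.homogeneousSubmodule (Fin (3 + 1)) O)) (Set.range (ι ≫ AlgebraicGeometry.Proj.map φ hφ' : H ⟶ (AlgebraicGeometry.Proj (MvPolynomial.homogeneousSubmodule (Fin (3 + 1)) O)))) X' σ' S') → (Set.range (ι ≫ AlgebraicGeometry.Proj.map φ hφ' : H ⟶ (AlgebraicGeometry.Proj (MvPolynomial.homogeneousSubmodule (Fin (3 + 1)) O)))) ⊆ (AlgebraicGeometry.Proj.toSpecZero (MvPolynomial.homogeneousSubmodule (Fin (3 + 1)) O) ≫ AlgebraicGeometry.Spec.map (CommRingCat.ofHom (algebraMap O (MvPolynomial.homogeneousSubmodule (Fin (3 + 1)) O 0)))) ⁻¹' {IsLocalRing.closedPoint O} → IsIrreducible (Set.range (ι ≫ AlgebraicGeometry.Proj.map φ hφ' : H ⟶ (AlgebraicGeometry.Proj (MvPolynomial.homogeneousSubmodule (Fin (3 + 1)) O)))) → IsClosed (Set.range (ι ≫ AlgebraicGeometry.Proj.map φ hφ' : H ⟶ (AlgebraicGeometry.Proj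 (MvPolynomial.homogeneousSubmodule (Fin (3 + 1)) O)))) →
        AlgebraicGeometry.IsIntegral (AlgebraicGeometry.Proj (MvPolynomial.homogeneousSubmodule (Fin (3 + 1)) O)) → IsLocallyNoetherian (AlgebraicGeometry.Proj (MvPolynomial.homogeneousSubmodule (Fin (3 + 1)) O)) → Literature.AlgebraicGeometry.Resolution.Scheme.IsRegular (AlgebraicGeometry.Proj (MvPolynomial.homogeneousSubmodule (Fin (3 + 1)) O)) → AlgebraicGeometry.IsProper (AlgebraicGeometry.Proj.toSpecZero (MvPolynomial.homogeneousSubmodule (Fin (3 + 1)) O) ≫ AlgebraicGeometry.Spec.map (CommRingCat.ofHom (algebraMap O (MvPolynomial.homogeneousSubmodule (Fin (3 + 1)) O 0)))) → AlgebraicGeometry.SmoothOfRelativeDimension 3 (AlgebraicGeometry.Proj.toSpecZero (MvPolynomial.homogeneousSubmodule (Fin (3 + 1)) O) ≫ AlgebraicGeometry.Spec.map (CommRingCat.ofHom (algebraMap O (MvPolynomial.homogeneousSubmodule (Fin (3 + 1)) O 0)))) →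
      -- the INITIAL stage and the initial host's model
      Ch (AlgebraicGeometry.Proj (MvPolynomial.homogeneousSubmodule (Fin (3 + 1)) O)) (𝟙 (AlgebraicGeometry.Proj (MvPolynomial.homogeneousSubmodule (Fin (3 + 1)) O))) (Set.range (ι ≫ AlgebraicGeometry.Proj.map φ hφ' : H ⟶ (AlgebraicGeometry.Proj (MvPolynomial.homogeneousSubmodule (Fin (3 + 1)) O)))) →
      TCPlus.LetterDatum O (AlgebraicGeometry.Proj (MvPolynomial.homogeneousSubmodule (Fin (3 + 1)) O)) (AlgebraicGeometry.Proj.toSpecZero (MvPolynomial.homogeneousSubmodule (Fin (3 + 1)) O) ≫ AlgebraicGeometry.Spec.map (CommRingCat.ofHom (algebraMap O (MvPolynomial.homogeneousSubmodule (Fin (3 + 1)) O 0)))) (Set.range (ι ≫ AlgebraicGeometry.Proj.map φ hφ' : H ⟶ (AlgebraicGeometry.Proj (MvPolynomial.homogeneousSubmodule (Fin (3 + 1)) O)))) (Literature.AlgebraicGeometry.Motives.projectiveSpace 3 k).left (AlgebraicGeometry.Proj (MvPolynomial.homogeneousSubmodule (Fin (3 + 1)) O)) (𝟙 (AlgebraicGeometry.Proj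 (MvPolynomial.homogeneousSubmodule (Fin (3 + 1)) O))) (AlgebraicGeometry.Proj.map φ hφ' : (Literature.AlgebraicGeometry.Motives.projectiveSpace 3 k).left ⟶ (AlgebraicGeometry.Proj (MvPolynomial.homogeneousSubmodule (Fin (3 + 1)) O))) E₀ →
      ∀ (ℓ : MvPolynomial (Fin (3 + 1)) k) (F₉ : AlgebraicGeometry.Scheme.{0}) (β : F₉ ⟶ (Literature.AlgebraicGeometry.Motives.projectiveSpace 3 k).left) (T₉ E₉ : Set F₉),
        E₀ = {y : (Literature.AlgebraicGeometry.Motives.projectiveSpace 3 k).left | ℓ ∈ (y : ProjectiveSpectrum (MvPolynomial.homogeneousSubmodule (Fin (3 + 1)) k)).asHomogeneousIdeal} →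
        ReachDirectPlanarNose₂ k 3 ℓ (Set.range ι) F₉ β T₉ E₉ →
        ∃ (X₉ : AlgebraicGeometry.Scheme.{0}) (σ₉ : X₉ ⟶ (AlgebraicGeometry.Proj (MvPolynomial.homogeneousSubmodule (Fin (3 + 1)) O))) (S₉ : Set X₉) (j₉ : F₉ ⟶ X₉) (t₉ : F₉ ⟶ AlgebraicGeometry.Spec (.of k)),
          Ch X₉ σ₉ S₉ ∧ AlgebraicGeometry.IsIntegral X₉ ∧ IsLocallyNoetherian X₉ ∧ Literature.AlgebraicGeometry.Resolution.Scheme.IsRegular X₉ ∧ AlgebraicGeometry.IsDominant (σ₉ ≫ (AlgebraicGeometry.Proj.toSpecZero (MvPolynomial.homogeneousSubmodule (Fin (3 + 1)) O) ≫ AlgebraicGeometry.Spec.map (CommRingCat.ofHom (algebraMap O (MvPolynomial.homogeneousSubmodule (Fin (3 + 1)) O 0))))) ∧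
          IsPullback j₉ t₉ (σ₉ ≫ (AlgebraicGeometry.Proj.toSpecZero (MvPolynomial.homogeneousSubmodule (Fin (3 + 1)) O) ≫ AlgebraicGeometry.Spec.map (CommRingCat.ofHom (algebraMap O (MvPolynomial.homogeneousSubmodule (Fin (3 + 1)) O 0))))) (AlgebraicGeometry.Spec.map (CommRingCat.ofHom θ)) ∧ j₉ '' T₉ = S₉ ∧ IsClosed T₉ ∧ IsIrreducible T₉ ∧ AlgebraicGeometry.IsIntegral F₉ ∧
          TCPlus.LetterDatum O (AlgebraicGeometry.Proj (MvPolynomial.homogeneousSubmodule (Fin (3 + 1)) O)) (AlgebraicGeometry.Proj.toSpecZero (MvPolynomial.homogeneousSubmodule (Fin (3 + 1)) O) ≫ AlgebraicGeometry.Spec.map (CommRingCat.ofHom (algebraMap O (MvPolynomial.homogeneousSubmodule (Fin (3 + 1)) O 0)))) (Set.range (ι ≫ AlgebraicGeometry.Proj.map φ hφ' : H ⟶ (AlgebraicGeometry.Proj (MvPolynomial.homogeneousSubmodule (Fin (3 + 1)) O)))) F₉ X₉ σ₉ j₉ E₉) := by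
  classical
  intro O _ _ _ _ _ θ hθ
  letI := MvPolynomial.gradedAlgebra (σ := Fin (3 + 1)) (R := O)
  letI := MvPolynomial.gradedAlgebra (σ := Fin (3 + 1)) (R := k)
  intro φ hφ' hφ Ch hChStep hChSplit hYsp hYirr hYcl hPint hPnoeth hPreg hqprop hqsm hCh₀ h𝓔₀ ℓ F₉ β T₉ E₉ hE hR
  obtain ⟨hE₉, Z, hZ, hZT, hTZ, hZinf, hZℓ, hZirr, hZdim, hGreg, hEreg, hEdim, hN1, ⟨e, g, B, r, hge, hgsq, hZeq, hℓB, hr, hdet⟩,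
    F₃, υ', hυ', γ', E', Es', Ns', K', htail, -⟩ := hR
  subst hE₉
  subst hE
  -- (1) the host's LINEAR normal form: `ℓ₀` from the engine, `λ = θ L̃` from the door's hyperplane coordinates
  obtain ⟨ℓ₀, hℓ₀1, hℓ₀0, hV₀⟩ : ∃ ℓ₀ : MvPolynomial (Fin (3 + 1)) k, ℓ₀.IsHomogeneous 1 ∧ ℓ₀ ≠ 0 ∧
      {y : (Literature.AlgebraicGeometry.Motives.projectiveSpace 3 k).left |
          ℓ ∈ (y : ProjectiveSpectrum (MvPolynomial.homogeneousSubmodule (Fin (3 + 1)) k)).asHomogeneousIdeal} =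
        {y : (Literature.AlgebraicGeometry.Motives.projectiveSpace 3 k).left |
          ℓ₀ ∈ (y : ProjectiveSpectrum (MvPolynomial.homogeneousSubmodule (Fin (3 + 1)) k)).asHomogeneousIdeal} := by
    rcases hE₀' with h0 | ⟨ℓ₀, h1, h2, h3⟩
    · exfalso
      obtain ⟨z, hz⟩ := hZinf.nonempty
      have : z ∈ (∅ : Set (Literature.AlgebraicGeometry.Motives.projectiveSpace 3 k).left) := by rw [← h0]; exact hZℓ hz
      exact this
    · exact ⟨ℓ₀, h1, h2, h3⟩
  have hunit : ∀ x : O, θ x ≠ 0 → IsUnit x := by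
    intro x hx
    by_contra h
    have hm : x ∈ IsLocalRing.maximalIdeal O := h
    rw [← IsLocalRing.eq_maximalIdeal (RingHom.ker_isMaximal_of_surjective θ hθ)] at hm
    exact hx hm
  obtain ⟨a₀, Bt, ct, Nt, -, -, -, hcta₀, -, -, -, hψk, hkerk⟩ :=
    Equinodal.HyperplaneLift.exists_hyperplane_lift θ hθ hunit B r hr hdet
  have hdvd : (∑ a', C (θ (ct a')) * X a' : MvPolynomial (Fin (3 + 1)) k) ∣ ℓ := hkerk ℓ hℓB
  have hV := Equinodal.HostNormalForm.setOf_mem_eq_setOf_mem_linear (r := 2) (fun a' => θ (ct a')) a₀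
    (by simp only [hcta₀, map_one]) ℓ hdvd ℓ₀ hℓ₀1 hℓ₀0 hV₀
  have hL1 : (∑ a', C (θ (ct a')) * X a' : MvPolynomial (Fin (3 + 1)) k).IsHomogeneous 1 :=
    Equinodal.HyperplaneAlg.isHomogeneous_sum_C_mul_X _ id
  have hL0 : (∑ a', C (θ (ct a')) * X a' : MvPolynomial (Fin (3 + 1)) k) ≠ 0 := by
    intro h
    have h1 := Equinodal.HyperplaneLift.coeff_single_sum_C_mul_X (fun a' => θ (ct a')) a₀
    rw [h, coeff_zero, hcta₀, map_one] at h1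
    exact zero_ne_one h1
  -- the door's `Z`, host clause and hyperplane equation in terms of `λ` (door spelling of the point sets)
  have hAB : {y : (Literature.AlgebraicGeometry.Motives.projectiveSpace 3 k).left |
        ℓ ∈ (y : ProjectiveSpectrum (MvPolynomial.homogeneousSubmodule (Fin (3 + 1)) k)).asHomogeneousIdeal} =
      {y : (Literature.AlgebraicGeometry.Motives.projectiveSpace 3 k).left |
        (∑ a', C (θ (ct a')) * X a' : MvPolynomial (Fin (3 + 1)) k) ∈
          (y : ProjectiveSpectrum (MvPolynomial.homogeneousSubmodule (Fin (3 + 1)) k)).asHomogeneousIdeal} :=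
    Set.ext fun y => Set.ext_iff.mp hV y
  have hZeq' : Z = {y : (Literature.AlgebraicGeometry.Motives.projectiveSpace 3 k).left |
      (∑ a', C (θ (ct a')) * X a' : MvPolynomial (Fin (3 + 1)) k) ∈ (y : ProjectiveSpectrum (MvPolynomial.homogeneousSubmodule (Fin (3 + 1)) k)).asHomogeneousIdeal ∧
      g ∈ (y : ProjectiveSpectrum (MvPolynomial.homogeneousSubmodule (Fin (3 + 1)) k)).asHomogeneousIdeal} := by
    rw [hZeq]
    ext y
    have hy := Set.ext_iff.mp hAB y
    simp only [Set.mem_setOf_eq] at hy ⊢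
    rw [hy]
  -- transport of the «host regular along Z̃» clause along `V₊ℓ = V₊λ` (by `subst` on a generalised set; `rw` cannot, the closure proof is frozen)
  have hEregT : ∀ (S₁ S₂ : Set (Literature.AlgebraicGeometry.Motives.projectiveSpace 3 k).left) (hS : S₁ = S₂) (h₁ : IsClosed (closure S₁))
      (h₂ : IsClosed (closure S₂)),
      (∀ (i : redSub (Literature.AlgebraicGeometry.Motives.projectiveSpace 3 k).left Z hZ ⟶ redSub (Literature.AlgebraicGeometry.Motives.projectiveSpace 3 k).left (closure S₁) h₁),
        i ≫ redSubι (Literature.AlgebraicGeometry.Motives.projectiveSpace 3 k).left (closure S₁) h₁ = redSubι (Literature.AlgebraicGeometry.Motives.projectiveSpace 3 k).left Z hZ →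
        ∀ z : ↥(redSub (Literature.AlgebraicGeometry.Motives.projectiveSpace 3 k).left Z hZ),
          IsRegularLocalRing ((redSub (Literature.AlgebraicGeometry.Motives.projectiveSpace 3 k).left (closure S₁) h₁).presheaf.stalk (i.base z))) →
      (∀ (i : redSub (Literature.AlgebraicGeometry.Motives.projectiveSpace 3 k).left Z hZ ⟶ redSub (Literature.AlgebraicGeometry.Motives.projectiveSpace 3 k).left (closure S₂) h₂),
        i ≫ redSubι (Literature.AlgebraicGeometry.Motives.projectiveSpace 3 k).left (closure S₂) h₂ = redSubι (Literature.AlgebraicGeometry.Motives.projectiveSpace 3 k).left Z hZ →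
        ∀ z : ↥(redSub (Literature.AlgebraicGeometry.Motives.projectiveSpace 3 k).left Z hZ),
          IsRegularLocalRing ((redSub (Literature.AlgebraicGeometry.Motives.projectiveSpace 3 k).left (closure S₂) h₂).presheaf.stalk (i.base z))) := by
    intro S₁ S₂ hS h₁ h₂ hreg; subst hS; exact hreg
  replace hEreg := hEregT _ _ hAB _ isClosed_closure hEreg
  -- (2) THE CENTRE: res-L1-w45b-stub-2's explicit smoothing of the planar trace
  obtain ⟨C₀, hCreg, hCfl, hCj⟩ := Equinodal.planar_trace_smoothing k O θ hθ φ hφ' hφ hPnoeth hPreg hqprop _ hL1 hL0 Z hZ hEreg hN1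
    e g B r hge hgsq hZeq' hψk hr hdet
  -- (3) the move upstairs: res-L1-w45b-nose-w1's ✓ `directNose_stage_zero_of_model` (= stage-0 HEND block from the model `C₀`, then PHASE 2 of ✓ `hsube_of_suppliers`)
  exact Equinodal.directNose_stage_zero_of_model hF k H ι hι hH O θ hθ φ hφ' hφ Ch hChStep hChSplit hYsp hYirr hYcl hPint hPnoeth hPreg hqprop hqsm hCh₀
    Z hZ hZT hTZ hZinf hZdim C₀ hCreg hCfl hCj F₃ υ' hυ' F₉ γ' T₉ E' Es' Ns' K' htail

end Summit.ResolutionOfSingularities.ResolutionOfSingularities.Cruxes.EquisingularLiftNat.Sections.Direct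

namespace Summit.ResolutionOfSingularities.ResolutionOfSingularities.Cruxes.EquisingularLiftNat.Sections

/-- **THE RUNG (R-ν3ᵈ): surfaces `H ⊂ ℙ³_k` with a hosted-nest / (EQUINODAL ∨ DIRECT)-PLANAR-NOSE resolution downstairs (door ν4 ∨ ν3ᵈ, ✓ `…NatResidueHypDefsE4`)
satisfy EL♮(3)'s conclusion, given (T-k).**  The type is the 46th texts' call shape: RUNGᵉ's binder convention with the ONE token
`NoseHypHostedNestEquinodalBTriplePrime₂ ↦ NoseHypHostedNestEquinodalDirectBTriplePrime₂`.  One application of K5ⁱ with `ReachI := ν4 ∨ ν3ᵈ` and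
`HSUBⁱ := hR.elim HSUBᵉ HSUBᵈ`. [OURS · L1 W4.5b · rung of the 46th cut; NOT a statement of the manuscript; EL♮(3) NOT proved] -/
theorem nose_direct_rung_three (p : ℕ) : EmbeddedCurveLiftFact → p.Prime →
    ∀ (k : Type) [Field k] [CharP k p] [IsAlgClosed k] (H : AlgebraicGeometry.Scheme.{0})
    (ι : H ⟶ (Literature.AlgebraicGeometry.Motives.projectiveSpace 3 k).left),
    AlgebraicGeometry.IsClosedImmersion ι → AlgebraicGeometry.IsIntegral H →
    (∀ y : (Literature.AlgebraicGeometry.Motives.projectiveSpace 3 k).left,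
      ∃ U : (Literature.AlgebraicGeometry.Motives.projectiveSpace 3 k).left.affineOpens,
        y ∈ (U : (Literature.AlgebraicGeometry.Motives.projectiveSpace 3 k).left.Opens) ∧ (ι.ker.ideal U).IsPrincipal) →
    NoseHypHostedNestEquinodalDirectBTriplePrime₂ k 3 H ι → ELNatConclusionO k 3 H ι := by
  intro hF hp k _ _ _ H ι hι hH hloc hν
  haveI := hι; haveI := hH
  letI := MvPolynomial.gradedAlgebra (σ := Fin (3 + 1)) (R := k)
  obtain ⟨E₀, hE₀, hres⟩ := hν
  -- F4's outer hypothesis on the initial host (the blob's disjunction minus its `¬ range ι ⊆ V₊ ℓ` conjunct); read by JINIT (ν4) and by HSUBᵈ (ν3ᵈ)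
  have hE₀' : E₀ = ∅ ∨ ∃ ℓ₀ : MvPolynomial (Fin (3 + 1)) k, ℓ₀.IsHomogeneous 1 ∧ ℓ₀ ≠ 0 ∧
      E₀ = {y : (Literature.AlgebraicGeometry.Motives.projectiveSpace 3 k).left | ℓ₀ ∈ (y : ProjectiveSpectrum (MvPolynomial.homogeneousSubmodule (Fin (3 + 1)) k)).asHomogeneousIdeal} :=
    hE₀.imp id (fun ⟨ℓ₀, h1, h0, _, h⟩ => ⟨ℓ₀, h1, h0, h⟩)
  -- HINIT by cases on the host; everything else is host-independent
  have HINIT : ∀ (O : Type) [CommRing O] [IsDomain O] [IsDiscreteValuationRing O] [IsAdicComplete (IsLocalRing.maximalIdeal O) O]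
      [IsAlgClosed (IsLocalRing.ResidueField O)] (θ : O →+* k), Function.Surjective θ → (letI := MvPolynomial.gradedAlgebra (σ := Fin (3 + 1)) (R := O);
      letI := MvPolynomial.gradedAlgebra (σ := Fin (3 + 1)) (R := k); ∀ (φ : MvPolynomial.homogeneousSubmodule (Fin (3 + 1)) O →+*ᵍ MvPolynomial.homogeneousSubmodule (Fin (3 + 1)) k)
        (hφ' : HomogeneousIdeal.irrelevant (MvPolynomial.homogeneousSubmodule (Fin (3 + 1)) k) ≤ (HomogeneousIdeal.irrelevant (MvPolynomial.homogeneousSubmodule (Fin (3 + 1)) O)).map φ), (∀ s, φ s = MvPolynomial.map θ s) →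
        TCPlus.LetterDatum O (AlgebraicGeometry.Proj (MvPolynomial.homogeneousSubmodule (Fin (3 + 1)) O)) (AlgebraicGeometry.Proj.toSpecZero (MvPolynomial.homogeneousSubmodule (Fin (3 + 1)) O) ≫ AlgebraicGeometry.Spec.map (CommRingCat.ofHom (algebraMap O (MvPolynomial.homogeneousSubmodule (Fin (3 + 1)) O 0)))) (Set.range (ι ≫ AlgebraicGeometry.Proj.map φ hφ' : H ⟶ (AlgebraicGeometry.Proj (MvPolynomial.homogeneousSubmodule (Fin (3 + 1)) O)))) (Literature.AlgebraicGeometry.Motives.projectiveSpace 3 k).left (AlgebraicGeometry.Proj (MvPolynomial.homogeneousSubmodule (Fin (3 + 1)) O)) (𝟙 (AlgebraicGeometry.Proj (MvPolynomial.homogeneousSubmodule (Fin (3 + 1)) O))) (AlgebraicGeometry.Proj.map φ hφ' : (Literature.AlgebraicGeometry.Motives.projectiveSpace 3 k).left ⟶ (AlgebraicGeometry.Proj (MvPolynomial.homogeneousSubmodule (Fin (3 + 1)) O))) E₀) := by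
    rcases hE₀ with rfl | ⟨ℓ, hℓ1, hℓ0, hHℓ, rfl⟩
    · exact hinit_empty k 3 H ι
    · exact hinit_hyperplane k 2 H ι ℓ hℓ1 hℓ0 hHℓ
  exact target_elnat_of_hostedSubchainResolutionᵢ p hp k 3 H ι hι hH hloc E₀ ReachHostedNoseBTriplePrime
    (fun ℓ F₉ β T₉ E₉ => ReachEquinodalPlanarNose₂ k 3 ℓ (Set.range ι) F₉ β T₉ E₉ ∨ ReachDirectPlanarNose₂ k 3 ℓ (Set.range ι) F₉ β T₉ E₉)
    HINIT (TCPlus.hpt_seam k 3) (TCPlus.hround_seam k hF) (hsubh_reachHostedNoseBTriplePrime_of_embeddedCurveLiftFact hF k)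
    (fun O _ _ _ _ _ θ hθ φ hφ' hφ Ch hChStep hChSplit hYsp hYirr hYcl hPint hPnoeth hPreg hqprop hqsm hCh₀ h𝓔₀ ℓ' F₉ β T₉ E₉ hE₀ hR =>
      hR.elim
        (fun hR => Equinodal.hsube_of_suppliers hF k O θ hθ _ _ _ Ch hChStep hChSplit hYsp hYirr hYcl hPint hPnoeth hPreg hqprop hqsm ℓ' (Set.range ι)
          (Equinodal.RPlus k O θ _ _ _ Ch)
          (Equinodal.jinit_rPlus₀_of_nearNode k H ι hι hH _ hE₀' (Equinodal.nose_regular_near_node k) O θ hθ φ hφ' hφ Ch hChStep hChSplit hYsp hYirr hYcl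
            hPint hPnoeth hPreg hqprop hqsm hCh₀ h𝓔₀ ℓ' hE₀)
          (Equinodal.hnode_rPlus k O θ hθ _ _ _ Ch hChStep hChSplit hYsp hYirr hYcl hPint hPnoeth hPreg hqprop hqsm)
          (Equinodal.hrdz_rPlus k O θ hθ _ _ _ Ch hChStep hChSplit hYsp hYirr hYcl hPint hPnoeth hPreg hqprop hqsm (hF k O θ hθ _ _))
          (Equinodal.hend_rPlus k O θ _ _ _ Ch) F₉ β T₉ E₉ hR)
        (fun hR => Direct.hsubd_of_smoothing hF k H ι hι hH E₀ hE₀' O θ hθ φ hφ' hφ Ch hChStep hChSplit hYsp hYirr hYcl hPint hPnoeth hPreg hqprop hqsm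
          hCh₀ h𝓔₀ ℓ' F₉ β T₉ E₉ hE₀ hR))
    hres

end Summit.ResolutionOfSingularities.ResolutionOfSingularities.Cruxes.EquisingularLiftNat.Sections

end
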